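import Literature.NumberTheory.Automorphic.HyperspecialUnitaryHeckeEigencharacter
import Literature.NumberTheory.Automorphic.HyperspecialUnitaryCompactOpen
import HarnessLib

/-!
# The unramified unitary Satake transform at the inert unramified places of a CM extension
# (`𝒮_w : ℋ(U(σ_w, J₀)(E_w), K₀) →ₐ[ℂ] ℂ[ℤ^N]`; independence of the uniformiser; injectivity; eigencharacters `λ_β`)

Topic `NumberTheory/Automorphic`; namespaces `Literature.NumberTheory.Automorphic.HermitianLattice.UnramifiedLocalConjDatum` (§1)
and `Literature.NumberTheory.Automorphic.UnitaryGroup` (§2) (lane `lit-hodgefound`, Track 2 foundations; seat `lit-hodgefound-p11`,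
generation 37, row g37-#17).  Definitions with bodies (`localConjUniformizer`, `unitarySatakeTransformAdic`,
`unitaryHeckeEigencharacterAdic`) + theorems; no named fact, no instance, no notation.  Packages the unramified unitary
local theory of generation 36 (`UnramifiedLocalConjDatum.satakeTransform`, `…_injective`, `heckeEigencharacter`) at the
completion `E_w` of a quadratic extension `E/F` of number fields at a place `w | v` fixed by the non-trivial automorphism `c`
with `v` unramified in `E` (`UnitaryGroup.unramifiedLocalConjDatum_adicCompletion`, generation 34), discharging the
residue-field finiteness through `finite_residueField_adicCompletion` (pointer (w3) of generation 36: `Finite 𝓀[E_w]` is a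
theorem, not an instance — it is supplied inside the definitions and proofs, so no statement carries a `[Finite …]` binder).

## The print

[CartierCorvallis1979] §IV (4.2) (the Satake transform at a non-archimedean place; `q` the residue cardinality);
[Minguez2011] §4 (unramified representations of `U(n)` at inert places and their Satake parameters); [GetzHahn2024] §7.5
(the unramified Hecke algebra at almost every place).  The transform does not depend on the uniformiser: §1.

## What is formalised

* §1 (any `Valued K ℤᵐ⁰`, two data `hd, hd'` with the same `σ` and uniformisers `ϖ, ϖ'`) **`iwasawaExp_eq_of_datum`**,
  `satakeVec_eq_of_datum`, `satakeTransform_eq_of_datum`, `heckeEigencharacter_eq_of_datum`.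
* §2 (number fields `E/F` quadratic, `c ≠ 1`, `w | v`, `c • w = w`, `v` unramified in `E`) `localConjUniformizer`,
  `unramifiedLocalConjDatum_localConjUniformizer`; **`unitarySatakeTransformAdic c hc1 v w hw hv`** :
  `ℋ(U(σ_w, J₀)(E_w), K₀) →ₐ[ℂ] ℂ[ℤ^N]`, `unitarySatakeTransformAdic_eq` (any datum computes it),
  **`unitarySatakeTransformAdic_injective`**, `unitarySatakeTransformAdic_doubleCosetOperator`;
  **`unitaryHeckeEigencharacterAdic … β`**, `_eq`, `_mul`, `_doubleCosetOperator`.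

## References
* [CartierCorvallis1979] P. Cartier, *Representations of 𝔭-adic groups: a survey*, PSPM 33.1 (1979), §IV (4.2).
* [Minguez2011] A. Mínguez, *Unramified representations of unitary groups*, in: *On the stabilization of the trace formula*
  (2011), §4.
* [GetzHahn2024] J. R. Getz, H. Hahn, *An Introduction to Automorphic Representations*, GTM 300 (2024), §7.5.
-/

noncomputable section

open scoped Valued WithZero Matrix MatrixGroups
open MonoidAlgebra Representation

/-! ## §1 Independence of the uniformiser -/

namespace Literature.NumberTheory.Automorphic.HermitianLattice

open Literature.NumberTheory.Automorphic.CartanUnique Literature.NumberTheory.Automorphic.SymplecticCartan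

variable {K : Type*} [Field K] [Valued K ℤᵐ⁰] {σ : K →+* K} {ϖ ϖ' : K} {N : ℕ}

namespace UnramifiedLocalConjDatum

/-- **The Iwasawa exponents do not depend on the uniformiser**: two data `hd, hd'` (same `σ`, uniformisers `ϖ, ϖ'`) have
`hd.iwasawaExp = hd'.iwasawaExp` — `diag(ϖ^a) = diag(ϖ'^a) · diag(u^a)` with `u = ϖ/ϖ'` a `σ`-fixed unit, `diag(u^a) ∈ K₀`.
[cite: CartierCorvallis1979, §IV (4.2)] [cite: BruhatTits1972, §4.4 (4.4.3)] -/
theorem iwasawaExp_eq_of_datum (hd : UnramifiedLocalConjDatum σ ϖ) (hd' : UnramifiedLocalConjDatum σ ϖ') :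
    hd.iwasawaExp (N := N) = hd'.iwasawaExp := by
  funext g
  obtain ⟨u, t, k, hu, ht, hk, h⟩ := hd.iwasawaExp_spec g
  have ha : ∀ i, hd.iwasawaExp g (Fin.rev i) = -hd.iwasawaExp g i := hd.iwasawaExp_rev g
  have hϖ0 := uniformizer_ne_zero hd.vϖ
  have hϖ0' := uniformizer_ne_zero hd'.vϖ
  -- the `σ`-fixed unit `u₀ = ϖ / ϖ'`
  have hu₀σ : σ (ϖ * ϖ'⁻¹) = ϖ * ϖ'⁻¹ := by rw [map_mul, map_inv₀, hd.σϖ, hd'.σϖ]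
  have hu₀0 : ϖ * ϖ'⁻¹ ≠ 0 := mul_ne_zero hϖ0 (inv_ne_zero hϖ0')
  have hu₀v : Valued.v (ϖ * ϖ'⁻¹) = 1 := by
    rw [map_mul, map_inv₀, hd.vϖ, hd'.vϖ, mul_inv_cancel₀ WithZero.exp_ne_zero]
  set d : unitaryGroupOfForm σ ((StdForm.antidiagonal N).over K) :=
    ⟨zpowDiagGL hu₀0 (hd.iwasawaExp g), zpowDiagGL_mem_unitaryGroupOfForm hu₀σ hu₀0 ha⟩ with hd_def
  set t' : unitaryGroupOfForm σ ((StdForm.antidiagonal N).over K) :=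
    ⟨zpowDiagGL hϖ0' (hd.iwasawaExp g), zpowDiagGL_mem_unitaryGroupOfForm hd'.σϖ hϖ0' ha⟩ with ht'_def
  have htd : t = t' * d := by
    refine Subtype.ext (Units.ext ?_)
    rw [Subgroup.coe_mul, Units.val_mul, ht, coe_zpowDiagGL, ht'_def, hd_def, coe_zpowDiagGL, coe_zpowDiagGL,
      Matrix.diagonal_mul_diagonal]
    congr 1
    funext i
    rw [← mul_zpow, mul_comm ϖ, ← mul_assoc, mul_inv_cancel₀ hϖ0', one_mul]
  have hdK : d ∈ unitaryInt σ ((StdForm.antidiagonal N).over K) := by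
    refine mem_unitaryInt_iff.2 ⟨fun i j => ?_, fun i j => ?_⟩
    · rw [hd_def, coe_zpowDiagGL, Matrix.diagonal_apply]
      split_ifs
      · rw [map_zpow₀, hu₀v, one_zpow]
      · rw [map_zero]; exact zero_le
    · rw [hd_def, ← zpowDiagGL_neg, coe_zpowDiagGL, Matrix.diagonal_apply]
      split_ifs
      · rw [map_zpow₀, hu₀v, one_zpow]
      · rw [map_zero]; exact zero_le
  symm
  refine hd'.iwasawaExp_eq hu (show ((t' : unitaryGroupOfForm σ ((StdForm.antidiagonal N).over K)) : GL (Fin N) K) =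
    zpowDiagGL (uniformizer_ne_zero hd'.vϖ) (hd.iwasawaExp g) from rfl) ((unitaryInt σ _).mul_mem hdK hk) ?_
  rw [h, htd]
  group

/-- The Satake transform on vectors does not depend on the uniformiser. [cite: CartierCorvallis1979, §IV (4.2)] -/
theorem satakeVec_eq_of_datum (hd : UnramifiedLocalConjDatum σ ϖ) (hd' : UnramifiedLocalConjDatum σ ϖ') :
    hd.satakeVec (N := N) = hd'.satakeVec := by
  refine LinearMap.ext fun x => ?_
  rw [hd.satakeVec_apply, hd'.satakeVec_apply, iwasawaExp_eq_of_datum hd hd']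

/-- **The unramified unitary Satake transform does not depend on the uniformiser.** [cite: CartierCorvallis1979, §IV (4.2)] -/
theorem satakeTransform_eq_of_datum [Finite 𝓀[K]] (hd : UnramifiedLocalConjDatum σ ϖ) (hd' : UnramifiedLocalConjDatum σ ϖ') :
    hd.satakeTransform (N := N) = hd'.satakeTransform := by
  refine AlgHom.ext fun T => ?_
  rw [hd.satakeTransform_apply, hd'.satakeTransform_apply, satakeVec_eq_of_datum hd hd']

/-- The eigencharacters `λ_β` do not depend on the uniformiser. [cite: CartierCorvallis1979, §IV (4.2)–(4.4)] -/
theorem heckeEigencharacter_eq_of_datum [Finite 𝓀[K]] (hd : UnramifiedLocalConjDatum σ ϖ)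
    (hd' : UnramifiedLocalConjDatum σ ϖ') (β : Fin N → ℂˣ) :
    hd.heckeEigencharacter β = hd'.heckeEigencharacter β := by
  rw [heckeEigencharacter, heckeEigencharacter, satakeTransform_eq_of_datum hd hd']

end UnramifiedLocalConjDatum

end Literature.NumberTheory.Automorphic.HermitianLattice

/-! ## §2 At the inert unramified places of a quadratic extension of number fields -/

open NumberField IsDedekindDomain

namespace Literature.NumberTheory.Automorphic.UnitaryGroup

open Literature.NumberTheory.Automorphic.HermitianLattice

variable {F E : Type} [Field F] [NumberField F] [Field E] [NumberField E] [Algebra F E] [Algebra.IsQuadraticExtension F E]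
  (c : E ≃ₐ[F] E) (hc1 : c ≠ 1) (v : HeightOneSpectrum (𝓞 F)) (w : PlacesOver E v) (hw : c • w.1 = w.1)
  (hv : Algebra.IsUnramifiedIn (𝓞 E) v.asIdeal) {N : ℕ}

/-- **A uniformiser of `E_w` carrying an `UnramifiedLocalConjDatum` for `σ_w = galAdicCompletionMap c`** (chosen from
`unramifiedLocalConjDatum_adicCompletion`). [cite: Minguez2011, §4] -/
def localConjUniformizer : w.1.adicCompletion E :=
  (unramifiedLocalConjDatum_adicCompletion c hc1 v w hw hv).choose

/-- The chosen uniformiser carries the datum. [cite: Minguez2011, §4] -/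
theorem unramifiedLocalConjDatum_localConjUniformizer :
    UnramifiedLocalConjDatum (galAdicCompletionMap (L := E) c hw) (localConjUniformizer c hc1 v w hw hv) :=
  (unramifiedLocalConjDatum_adicCompletion c hc1 v w hw hv).choose_spec

/-- **THE UNRAMIFIED SATAKE TRANSFORM AT `w`**: `𝒮_w : ℋ(U(σ_w, J₀)(E_w), K₀) →ₐ[ℂ] ℂ[ℤ^N]` in the `δ^{1/2}` normalisation
(`q_w^{1/2} = residueCardSqrt E_w`), the residue-field finiteness supplied by `finite_residueField_adicCompletion`.
[cite: CartierCorvallis1979, §IV (4.2)] [cite: Minguez2011, §4] -/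
def unitarySatakeTransformAdic :
    heckeAlgebra ℂ (unitaryGroupOfForm (galAdicCompletionMap (L := E) c hw)
        ((StdForm.antidiagonal N).over (w.1.adicCompletion E)))
      (unitaryInt (galAdicCompletionMap (L := E) c hw) ((StdForm.antidiagonal N).over (w.1.adicCompletion E))) →ₐ[ℂ]
      AddMonoidAlgebra ℂ (Fin N → ℤ) :=
  haveI := finite_residueField_adicCompletion E w.1
  (unramifiedLocalConjDatum_localConjUniformizer c hc1 v w hw hv).satakeTransform

/-- **Any datum computes `𝒮_w`** (independence of the uniformiser). [cite: CartierCorvallis1979, §IV (4.2)] -/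
theorem unitarySatakeTransformAdic_eq {ϖ : w.1.adicCompletion E}
    (hd : UnramifiedLocalConjDatum (galAdicCompletionMap (L := E) c hw) ϖ) :
    haveI := finite_residueField_adicCompletion E w.1
    unitarySatakeTransformAdic c hc1 v w hw hv (N := N) = hd.satakeTransform :=
  haveI := finite_residueField_adicCompletion E w.1
  (unramifiedLocalConjDatum_localConjUniformizer c hc1 v w hw hv).satakeTransform_eq_of_datum hd

/-- **`𝒮_w` IS INJECTIVE** (generation 36's `satakeTransform_injective` at `E_w`). [cite: CartierCorvallis1979, §IV Thm. 4.1] -/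
theorem unitarySatakeTransformAdic_injective :
    Function.Injective (unitarySatakeTransformAdic c hc1 v w hw hv (N := N)) :=
  haveI := finite_residueField_adicCompletion E w.1
  (unramifiedLocalConjDatum_localConjUniformizer c hc1 v w hw hv).satakeTransform_injective

/-- **`𝒮_w(T_g) = Σ_{α ∈ K₀ g K₀/K₀} q_w^{-⟨ν, a(α)⟩/2} x^{a(α)}`** (the Hecke pair from `isHeckeTriple_unitaryInt_adicCompletion`;
the exponents read in any datum `hd`). [cite: CartierCorvallis1979, §IV (4.2)] -/
theorem unitarySatakeTransformAdic_doubleCosetOperator {ϖ : w.1.adicCompletion E}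
    (hd : UnramifiedLocalConjDatum (galAdicCompletionMap (L := E) c hw) ϖ)
    (g : unitaryGroupOfForm (galAdicCompletionMap (L := E) c hw) ((StdForm.antidiagonal N).over (w.1.adicCompletion E))) :
    haveI := isHeckeTriple_unitaryInt_adicCompletion c v w hw ((StdForm.antidiagonal N).over (w.1.adicCompletion E))
    unitarySatakeTransformAdic c hc1 v w hw hv (heckeAlgebra.doubleCosetOperator
        (unitaryInt (galAdicCompletionMap (L := E) c hw) ((StdForm.antidiagonal N).over (w.1.adicCompletion E))) g) =
      ∑ α ∈ (finite_orbit_quotient (unitaryInt (galAdicCompletionMap (L := E) c hw)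
          ((StdForm.antidiagonal N).over (w.1.adicCompletion E))) g).toFinset,
        AddMonoidAlgebra.single (hd.iwasawaExp α.out)
          (satakeWeight (residueCardSqrt (w.1.adicCompletion E)) (hd.iwasawaExp α.out)) := by
  haveI := isHeckeTriple_unitaryInt_adicCompletion c v w hw ((StdForm.antidiagonal N).over (w.1.adicCompletion E))
  haveI := finite_residueField_adicCompletion E w.1
  rw [unitarySatakeTransformAdic_eq c hc1 v w hw hv hd, hd.satakeTransform_doubleCosetOperator]

/-- **The unramified Hecke eigencharacters `λ_β` at `w`** (`β ∈ (ℂˣ)^N` the torus parameter).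
[cite: CartierCorvallis1979, §IV (4.2)–(4.4)] [cite: Minguez2011, §4] -/
def unitaryHeckeEigencharacterAdic (β : Fin N → ℂˣ) :
    heckeAlgebra ℂ (unitaryGroupOfForm (galAdicCompletionMap (L := E) c hw)
        ((StdForm.antidiagonal N).over (w.1.adicCompletion E)))
      (unitaryInt (galAdicCompletionMap (L := E) c hw) ((StdForm.antidiagonal N).over (w.1.adicCompletion E))) →ₐ[ℂ] ℂ :=
  haveI := finite_residueField_adicCompletion E w.1
  (unramifiedLocalConjDatum_localConjUniformizer c hc1 v w hw hv).heckeEigencharacter β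

/-- Any datum computes `λ_β`. [cite: CartierCorvallis1979, §IV (4.2)–(4.4)] -/
theorem unitaryHeckeEigencharacterAdic_eq {ϖ : w.1.adicCompletion E}
    (hd : UnramifiedLocalConjDatum (galAdicCompletionMap (L := E) c hw) ϖ) (β : Fin N → ℂˣ) :
    haveI := finite_residueField_adicCompletion E w.1
    unitaryHeckeEigencharacterAdic c hc1 v w hw hv β = hd.heckeEigencharacter β :=
  haveI := finite_residueField_adicCompletion E w.1
  (unramifiedLocalConjDatum_localConjUniformizer c hc1 v w hw hv).heckeEigencharacter_eq_of_datum hd β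

/-- `λ_β` is multiplicative. [cite: CartierCorvallis1979, §IV (4.2)–(4.4)] -/
theorem unitaryHeckeEigencharacterAdic_mul (β : Fin N → ℂˣ)
    (S T : heckeAlgebra ℂ (unitaryGroupOfForm (galAdicCompletionMap (L := E) c hw)
        ((StdForm.antidiagonal N).over (w.1.adicCompletion E)))
      (unitaryInt (galAdicCompletionMap (L := E) c hw) ((StdForm.antidiagonal N).over (w.1.adicCompletion E)))) :
    unitaryHeckeEigencharacterAdic c hc1 v w hw hv β (S * T) =
      unitaryHeckeEigencharacterAdic c hc1 v w hw hv β S * unitaryHeckeEigencharacterAdic c hc1 v w hw hv β T :=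
  map_mul _ S T

/-- **`λ_β = ev_β ∘ 𝒮_w`.** [cite: CartierCorvallis1979, §IV (4.2)] -/
theorem unitaryHeckeEigencharacterAdic_apply (β : Fin N → ℂˣ)
    (T : heckeAlgebra ℂ (unitaryGroupOfForm (galAdicCompletionMap (L := E) c hw)
        ((StdForm.antidiagonal N).over (w.1.adicCompletion E)))
      (unitaryInt (galAdicCompletionMap (L := E) c hw) ((StdForm.antidiagonal N).over (w.1.adicCompletion E)))) :
    unitaryHeckeEigencharacterAdic c hc1 v w hw hv β T = laurentEvalAt β (unitarySatakeTransformAdic c hc1 v w hw hv T) :=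
  rfl

end Literature.NumberTheory.Automorphic.UnitaryGroup

end
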